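import Summits.QuantumFields.YangMills.Theorems.FluctuationComparisonRegPrIntLOrganTangentChartRepresentation
import HarnessLib

/-!
# Crux `FluctuationComparisonRegPrIntL` (stmt-QuantumFields-20520, rung R3), PATH-B organ, v18 (H-currency) — (WD) THE WINDOW DENSITY OF `descendTo_* dU_K` IS POSITIVE
# (from the fibred chart: identity [6] at the window + section `havgΦ` + chart-mass positivity (C3)) — the transfer datum «`0 < T_{j,K}(1)` on the window»

Cell `ym3-torus` (YM ladder rung R3 = continuum `SU(2)` Yang–Mills on the three-torus — a RUNG: NOT d = 4, NOT infinite volume, NOT a mass gap, NOT Clay).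
Width seat `ym-ust-20520-w5` (gen 23), `--supports stmt-QuantumFields-20520 --as helper`, count-neutral, no registry ∕ binder ∕ `Lines/` edit, DEFINITION-FREE,
default heartbeats.  Over ✓(L22) `…OrganTangentChartRepresentation` (imports only).

WHAT THIS IS.  ★`exists_windowDensity_of_fibredChart`: every `dU_j`-positive subset `A` of the window `{PlaqSmall θBal_j}` has `descendTo_* dU_K`-measure
`≥ dU_K(d⁻¹A ∩ S) = ∫_A ∫ J(V,z) dτ d dU_j > 0`, so `dU_j|window ≪ descendTo_* dU_K`; hence the Radon–Nikodym density of `descendTo_* dU_K` w.r.t. `dU_j`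
(✓`absolutelyContinuous_map_descendTo`) is positive `dU_j`-a.e. on the window, and its real version REPAIRED on a `dU_j`-null set is a measurable `rj` with `0 < rj V` at
EVERY window point and `descendTo_* dU_K = dU_j.withDensity (ofReal ∘ rj)`.  USE: it is exactly the transfer triple `(mY := dU_K, rj, hcons)` that ✓(L22)
`mfun_eq_chartRatio_on_window`, ✓(L21b) `ae_on_window_fibreMean_transport_descendTo`, ✓(L21e) `abs_le_on_of_ae_map_descendTo` and ✓KNIT's
`ae_on_of_ae_map_of_ac_of_map_eq` take — obtained from the chart letters ALONE (no cut-tower law), as needed when `σ`, `mfun`, `lam` are ∀-bound binders of a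
hypothesis text (LEAD w3 g25 №30; the (JV-rep) bridge of the Jensen knit, px5 g19's docking list §3).

HONEST FRAMING: Radon–Nikodym ∕ null-set bookkeeping; nothing of Bałaban's analysis is asserted or proved; SpreadFibreLawH ∕ LIN″ ∕ JVARᵘ-H″ ∕ O1ᵘ-H v2.x ∕ S1aᴴ ∕
26243 ∕ S2α′ ∕ S2β OPEN; crux 20520 `FluctuationComparisonRegPrIntL` ∕ `YM3TorusSU2` NOT proved; no summit ∕ sub-problem statement is proved; registry untouched; rung
R3 = SU(2) YM₃ on T³ at fixed lattice data — NOT d = 4, NOT infinite volume, NOT a mass gap, NOT Clay; the Yang–Mills mass gap is NOT proved.  [folklore].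
-/

set_option autoImplicit false

noncomputable section

namespace Summit.QuantumFields.YangMills.Theorems.OrganTangentWindowDensity

open MeasureTheory ProbabilityTheory Filter Topology Set Function
open scoped ENNReal NNReal
open Literature.MathematicalPhysics.QuantumFieldTheory.Balaban1983to89
open T3ContinuumYM3Torus T3NestedUnitLaws T3UnitLawDensityEML T3UnitScaleTilt T3LevelShift T3TiltDescent T4Continuum
open Literature.MathematicalPhysics.QuantumFieldTheory.Balaban1983to89.T3OrbitAverage
open Summit.QuantumFields.YangMills.Theorems.OrganTangentFibreMeanTools
open Summit.QuantumFields.YangMills.Theorems.FluctuationComparisonRegPrIntLOrganTangentAPackageDescendTo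
  (measurableSet_multiWindow absolutelyContinuous_map_descendTo)

/-! ## §1 The window density -/

/-- ★ **A POSITIVE WINDOW DENSITY FOR `descendTo_* dU_K`** (LEAD w3 g25 №30's «`0 < T_{j,K}(1)` on the window»).  From the chart identity [6] at the window,
the section letter `havgΦ` and the (C3) chart-mass positivity: `dU_j`-positive subsets of the window are `descendTo_* dU_K`-positive, so the Radon–Nikodym density
(✓`absolutelyContinuous_map_descendTo`) is positive `dU_j`-a.e. on the window and admits a measurable real version `rj > 0` at EVERY window point with
`descendTo_* dU_K = dU_j.withDensity (ofReal ∘ rj)`.  [cite: Balaban1985Averaging, (10)-(13) p.19; Balaban1987RG1, (0.13) p.254] ([folklore] Radon–Nikodym bookkeeping) -/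
theorem exists_windowDensity_of_fibredChart
    (F : T3Family) (γ b₀ p₀ : ℝ) (j K : ℕ) (hjK : j ≤ K)
    {Z : Type*} [MeasurableSpace Z] (τ : Measure Z) [SFinite τ]
    (Φ : GaugeField (F.P j) 0 ↥(Matrix.specialUnitaryGroup (Fin 2) ℂ) × Z → GaugeField (F.P K) 0 ↥(Matrix.specialUnitaryGroup (Fin 2) ℂ))
    (hΦ : Measurable Φ)
    (J : GaugeField (F.P j) 0 ↥(Matrix.specialUnitaryGroup (Fin 2) ℂ) × Z → ℝ≥0) (hJ : Measurable J)
    (S : Set (GaugeField (F.P K) 0 ↥(Matrix.specialUnitaryGroup (Fin 2) ℂ)))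
    (havgΦ : ∀ V ∈ {V | PlaqSmall (θBal F.L γ b₀ p₀ j) V}, ∀ z, descendTo F ℰp j K hjK (Φ (V, z)) = V)
    (hmap : (fieldMeasure (F.P K) 0 ↥(Matrix.specialUnitaryGroup (Fin 2) ℂ)).restrict
        (descendTo F ℰp j K hjK ⁻¹' {V | PlaqSmall (θBal F.L γ b₀ p₀ j) V} ∩ S) =
      ((((fieldMeasure (F.P j) 0 ↥(Matrix.specialUnitaryGroup (Fin 2) ℂ)).restrict {V | PlaqSmall (θBal F.L γ b₀ p₀ j) V}).prod τ).withDensity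
        (fun p => (J p : ℝ≥0∞))).map Φ)
    (hmass : ∀ V, PlaqSmall (θBal F.L γ b₀ p₀ j) V →
      0 < ∫⁻ z in {z | ∀ (n : ℕ) (hjn : j + 1 ≤ n) (hnK : n ≤ K), PlaqSmall (24 / 25 * θBal F.L γ b₀ p₀ n) (descendTo F ℰp n K hnK (Φ (V, z)))},
        (J (V, z) : ℝ≥0∞) ∂τ) :
    ∃ rj : GaugeField (F.P j) 0 ↥(Matrix.specialUnitaryGroup (Fin 2) ℂ) → ℝ, Measurable rj ∧
      (∀ V, PlaqSmall (θBal F.L γ b₀ p₀ j) V → 0 < rj V) ∧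
      Measure.map (descendTo F ℰp j K hjK) (fieldMeasure (F.P K) 0 ↥(Matrix.specialUnitaryGroup (Fin 2) ℂ)) =
        (fieldMeasure (F.P j) 0 ↥(Matrix.specialUnitaryGroup (Fin 2) ℂ)).withDensity (fun V => ENNReal.ofReal (rj V)) := by
  classical
  haveI : BorelSpace (GaugeField (F.P K) 0 ↥(Matrix.specialUnitaryGroup (Fin 2) ℂ)) := T3OrbitAverage.instBorelSpaceGaugeField
  haveI : BorelSpace (GaugeField (F.P j) 0 ↥(Matrix.specialUnitaryGroup (Fin 2) ℂ)) := T3OrbitAverage.instBorelSpaceGaugeField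
  set Hf : Measure (GaugeField (F.P K) 0 ↥(Matrix.specialUnitaryGroup (Fin 2) ℂ)) := fieldMeasure (F.P K) 0 ↥(Matrix.specialUnitaryGroup (Fin 2) ℂ) with hHf
  set Hc : Measure (GaugeField (F.P j) 0 ↥(Matrix.specialUnitaryGroup (Fin 2) ℂ)) := fieldMeasure (F.P j) 0 ↥(Matrix.specialUnitaryGroup (Fin 2) ℂ) with hHc
  haveI : IsProbabilityMeasure Hf := Missing.isProbabilityMeasure_fieldMeasure _ _
  haveI : IsProbabilityMeasure Hc := Missing.isProbabilityMeasure_fieldMeasure _ _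
  have hd : Measurable (descendTo F ℰp j K hjK :
      GaugeField (F.P K) 0 ↥(Matrix.specialUnitaryGroup (Fin 2) ℂ) → GaugeField (F.P j) 0 ↥(Matrix.specialUnitaryGroup (Fin 2) ℂ)) :=
    measurable_descendTo F ℰp measurableE_ℰp hjK
  set ν : Measure (GaugeField (F.P j) 0 ↥(Matrix.specialUnitaryGroup (Fin 2) ℂ)) := Hf.map (descendTo F ℰp j K hjK) with hν
  haveI : IsProbabilityMeasure ν := Measure.isProbabilityMeasure_map hd.aemeasurable
  set W : Set (GaugeField (F.P j) 0 ↥(Matrix.specialUnitaryGroup (Fin 2) ℂ)) := {V | PlaqSmall (θBal F.L γ b₀ p₀ j) V} with hW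
  have hWopen : IsOpen W := by
    have e : W = ⋂ p : Plaq (F.P j) 0, {U | dist1 (GaugeField.plaqHol U p) < θBal F.L γ b₀ p₀ j} := by
      ext U; simp only [hW, PlaqSmall, Set.mem_setOf_eq, Set.mem_iInter]
    rw [e]
    exact isOpen_iInter_of_finite fun p => isOpen_lt (continuous_dist1_plaqHol p) continuous_const
  have hWm : MeasurableSet W := hWopen.measurableSet
  have hac : ν ≪ Hc := absolutelyContinuous_map_descendTo F j K hjK
  have hνeq : Hc.withDensity (ν.rnDeriv Hc) = ν := Measure.withDensity_rnDeriv_eq ν Hc hac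
  -- `dU_j`-positive subsets of the window are `ν`-positive
  have hJmeas : Measurable fun V => ∫⁻ z, (J (V, z) : ℝ≥0∞) ∂τ := (hJ.coe_nnreal_ennreal).lintegral_prod_right'
  have hkey : ∀ A : Set (GaugeField (F.P j) 0 ↥(Matrix.specialUnitaryGroup (Fin 2) ℂ)), MeasurableSet A → A ⊆ W → ν A = 0 → Hc A = 0 := by
    intro A hA hAW hνA
    -- the chart measure of `A × Z` is at most `ν A`
    set μ : Measure (GaugeField (F.P j) 0 ↥(Matrix.specialUnitaryGroup (Fin 2) ℂ) × Z) :=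
      (((Hc.restrict W).prod τ).withDensity fun p => (J p : ℝ≥0∞)) with hμ
    have hsub : A ×ˢ (Set.univ : Set Z) ⊆ Φ ⁻¹' (descendTo F ℰp j K hjK ⁻¹' A) := by
      rintro ⟨V, z⟩ ⟨hV, -⟩
      show descendTo F ℰp j K hjK (Φ (V, z)) ∈ A
      rw [havgΦ V (hAW hV) z]; exact hV
    have h1 : μ (A ×ˢ (Set.univ : Set Z)) ≤ ν A := by
      calc μ (A ×ˢ (Set.univ : Set Z)) ≤ μ (Φ ⁻¹' (descendTo F ℰp j K hjK ⁻¹' A)) := measure_mono hsub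
        _ = (μ.map Φ) (descendTo F ℰp j K hjK ⁻¹' A) := (Measure.map_apply hΦ (hd hA)).symm
        _ = (Hf.restrict (descendTo F ℰp j K hjK ⁻¹' W ∩ S)) (descendTo F ℰp j K hjK ⁻¹' A) := by rw [hμ, ← hmap]
        _ ≤ Hf (descendTo F ℰp j K hjK ⁻¹' A) := Measure.restrict_le_self _
        _ = ν A := (Measure.map_apply hd hA).symm
    have h0 : μ (A ×ˢ (Set.univ : Set Z)) = 0 := le_antisymm (h1.trans hνA.le) bot_le
    -- that chart measure is `∫⁻_A ∫⁻ J dτ d dU_j`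
    have h2 : μ (A ×ˢ (Set.univ : Set Z)) = ∫⁻ V in A, ∫⁻ z, (J (V, z) : ℝ≥0∞) ∂τ ∂Hc := by
      rw [hμ, withDensity_apply _ (hA.prod MeasurableSet.univ), ← Measure.prod_restrict, Measure.restrict_univ,
        Measure.restrict_restrict hA, Set.inter_eq_left.mpr hAW,
        lintegral_prod _ (hJ.coe_nnreal_ennreal).aemeasurable]
    rw [h2] at h0
    -- the inner integral is positive on the window, so `dU_j A = 0`
    have hg0 : (fun V => ∫⁻ z, (J (V, z) : ℝ≥0∞) ∂τ) =ᵐ[Hc.restrict A] 0 := (lintegral_eq_zero_iff hJmeas).mp h0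
    have hgA : ∀ᵐ V ∂(Hc.restrict A), V ∉ A := by
      have h3 : ∀ᵐ V ∂(Hc.restrict A), V ∈ A := ae_restrict_mem hA
      filter_upwards [hg0, h3] with V hV hVA
      intro _
      have hpos : 0 < ∫⁻ z, (J (V, z) : ℝ≥0∞) ∂τ :=
        lt_of_lt_of_le (hmass V (hAW hVA)) (setLIntegral_le_lintegral _ _)
      exact hpos.ne' hV
    have h4 : (Hc.restrict A) {V | ¬ (V ∉ A)} = 0 := ae_iff.mp hgA
    have h5 : {V : GaugeField (F.P j) 0 ↥(Matrix.specialUnitaryGroup (Fin 2) ℂ) | ¬ (V ∉ A)} = A := by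
      ext V; simp only [Set.mem_setOf_eq, not_not]
    rwa [h5, Measure.restrict_apply_self] at h4
  have hWac : Hc.restrict W ≪ ν := by
    refine Measure.AbsolutelyContinuous.mk fun A hA hνA => ?_
    rw [Measure.restrict_apply hA]
    exact hkey (A ∩ W) (hA.inter hWm) Set.inter_subset_right (measure_mono_null Set.inter_subset_left hνA)
  -- the density is positive `dU_j`-a.e. on the window and finite a.e.
  have hposν : ∀ᵐ V ∂ν, 0 < ν.rnDeriv Hc V := Measure.rnDeriv_pos hac
  have hposW : ∀ᵐ V ∂Hc, V ∈ W → 0 < ν.rnDeriv Hc V := (ae_restrict_iff' hWm).mp (hWac.ae_le hposν)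
  have hlt : ∀ᵐ V ∂Hc, ν.rnDeriv Hc V < ⊤ := Measure.rnDeriv_lt_top ν Hc
  -- the repaired real version
  have hRm : Measurable fun V => (ν.rnDeriv Hc V).toReal := (Measure.measurable_rnDeriv ν Hc).ennreal_toReal
  have hBad : MeasurableSet {V | V ∈ W ∧ (ν.rnDeriv Hc V).toReal = 0} := hWm.inter (hRm (measurableSet_singleton 0))
  refine ⟨fun V => if V ∈ W ∧ (ν.rnDeriv Hc V).toReal = 0 then 1 else (ν.rnDeriv Hc V).toReal, ?_, ?_, ?_⟩
  · exact Measurable.ite hBad measurable_const hRm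
  · intro V hV
    show 0 < (if V ∈ W ∧ (ν.rnDeriv Hc V).toReal = 0 then (1 : ℝ) else (ν.rnDeriv Hc V).toReal)
    by_cases h : (ν.rnDeriv Hc V).toReal = 0
    · have hc : V ∈ W ∧ (ν.rnDeriv Hc V).toReal = 0 := ⟨hV, h⟩
      rw [if_pos hc]; exact zero_lt_one
    · have hc : ¬ (V ∈ W ∧ (ν.rnDeriv Hc V).toReal = 0) := fun hh => h hh.2
      rw [if_neg hc]
      exact lt_of_le_of_ne ENNReal.toReal_nonneg (Ne.symm h)
  · have hcongr : (fun V => ENNReal.ofReal (if V ∈ W ∧ (ν.rnDeriv Hc V).toReal = 0 then (1 : ℝ) else (ν.rnDeriv Hc V).toReal))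
        =ᵐ[Hc] ν.rnDeriv Hc := by
      filter_upwards [hposW, hlt] with V hVpos hVlt
      by_cases hc : V ∈ W ∧ (ν.rnDeriv Hc V).toReal = 0
      · exfalso
        have h1 := hVpos hc.1
        have h2 : (ν.rnDeriv Hc V).toReal ≠ 0 := (ENNReal.toReal_pos h1.ne' hVlt.ne).ne'
        exact h2 hc.2
      · show ENNReal.ofReal (if V ∈ W ∧ (ν.rnDeriv Hc V).toReal = 0 then (1 : ℝ) else (ν.rnDeriv Hc V).toReal) = ν.rnDeriv Hc V
        rw [if_neg hc]
        exact ENNReal.ofReal_toReal hVlt.ne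
    rw [withDensity_congr_ae hcongr, hνeq]


end Summit.QuantumFields.YangMills.Theorems.OrganTangentWindowDensity

end
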